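import Literature.NumberTheory.LFunctions.FordLemma34
import Literature.NumberTheory.LFunctions.FordTheorem3RowLargeK
import Literature.NumberTheory.LFunctions.FordLemma36Step
import Literature.NumberTheory.LFunctions.FordVinogradovDiagonal
import Literature.NumberTheory.LFunctions.VinogradovMeanValueBound
import HarnessLib

/-!
# Ford's Theorem 3 for `k ≥ 1191` from Lemma 3.4 (the data of Lemma 3.5 made explicit)

Topic `Literature/NumberTheory/LFunctions`. Everything here is PROVED; no named fact is introduced.

`FordL36.row_of_lemma35_data` (`FordTheorem3RowLargeK.lean`) derives the row
`(ρ, θ) = (3.21432, 2.3291)` of (1.7) of K. Ford, Proc. LMS 85 (2002), for `k ≥ 1191`, from abstract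
"data of Lemma 3.5": sequences `δ_n = Δ_n/k²`, `C_n` with the one-step inequalities of Lemma 3.6 and
the bounds `J_{nk,k}(P) ≤ C_n P^{2nk − k(k+1)/2 + Δ_n}`. This file **constructs that data from
Lemma 3.4** (`FordP1.Lemma34Hyp k ω` at `ω = 0.06`, now a theorem of the tree: `FordVK.lemma34Hyp_of`,
`FordLemma34.lean` — so the row below is UNCONDITIONAL): Ford's recursion `Δ₁ = (k² − k)/2`, `r_n = ⌊k − Δ_n/k + 1⌋`, `j` maximal in (3.8),
`Δ_{n+1} = δ₀(k, r_n, Δ_n)`, `C₁ = k!`, `C_{n+1} = C_n max(k^{3k} η^{4nk+k²}, V^{(k+1)(Δ_n−Δ_{n+1})})`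
(Lemma 3.5; the recursion is frozen once `Δ_n ≤ k`, where Lemma 3.6 no longer uses it), the step
being justified by Lemma 3.4 on `P ≥ V^{k+1}` and by `J_{(n+1)k} ≤ P^{2k} J_{nk}` below (proof of
Lemma 3.5), and the one-step inequalities by `FordLemma36Step.lean` ((3.11), (3.13)–(3.17)).

* `FordP1.lemma35_step` — the induction step of Lemma 3.5 from Lemma 3.4 (real form);
* `FordP1.seqAux`, `FordP1.rL36`, `FordP1.jL36` — the recursion;
* `FordP1.row_ge_1191` — **the row `(3.21432, 2.3291)` for `k ≥ 1191`** (unconditional).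

## References

* K. Ford, Proc. London Math. Soc. (3) 85 (2002), 565–633; arXiv:1910.08209: Lemmas 3.4, 3.5, 3.6,
  Theorem 3 and its proof ("Suppose first that k ≥ 1000 …"). [Ford2002]
-/

open Finset Real

namespace Literature.NumberTheory.LFunctions
namespace FordP1

/-! ### The induction step of Lemma 3.5 -/

/-- **Lemma 3.5, induction step** (from Lemma 3.4): if `J_{nk}(P) ≤ C P^{2nk − T + Δ}` (`P ≥ 1`) and
`r, j` are admissible with `δ₀ ≤ Δ' ≤ Δ`, then
`J_{(n+1)k}(P) ≤ C max(k^{3k}η^{4nk+k²}, V^{(k+1)(Δ−Δ')}) P^{2(n+1)k − T + Δ'}` for all `P ≥ 1`.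
[cite: Ford2002, Lemma 3.5 (proof)] -/
theorem lemma35_step {k : ℕ} {ω : ℝ} (hk : 1 ≤ k) (hω : 0 < ω) (hL34 : Lemma34Hyp k ω)
    {n r j : ℕ} {Δ Δ' C : ℝ} (hC : 0 ≤ C) (h1n : 1 ≤ n) (hnk : n * k ≤ k ^ 3) (hr4 : 4 ≤ r)
    (hrk : r ≤ k) (hj2 : 2 ≤ j) (hj9 : 10 * j ≤ 9 * r)
    (hj38 : ((j : ℝ) - 1) * ((j : ℝ) - 2) ≤ 2 * Δ - ((k : ℝ) - r) * ((k : ℝ) - r + 1))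
    (hφ : ∀ J : ℕ, 1 ≤ J → J ≤ j → 1 / ((k : ℝ) + 1) ≤ phiF k r Δ j J)
    (hΔ1 : dnext k r Δ j ≤ Δ') (hΔ2 : Δ' ≤ Δ)
    (hJ : ∀ P : ℕ, 1 ≤ P → (VMV.J k (n * k) (Finset.Icc (1 : ℤ) P) : ℝ) ≤ C * (P : ℝ) ^ expo k n Δ) :
    ∀ P : ℕ, 1 ≤ P → (VMV.J k ((n + 1) * k) (Finset.Icc (1 : ℤ) P) : ℝ) ≤
      C * max ((k : ℝ) ^ (3 * k) * (1 + ω) ^ (4 * (n * k) + k ^ 2)) (Vf k ω ^ (((k : ℝ) + 1) * (Δ - Δ'))) *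
        (P : ℝ) ^ expo k (n + 1) Δ' := by
  intro P hP
  have hP0 : (0 : ℝ) < P := by exact_mod_cast hP
  have hP1 : (1 : ℝ) ≤ P := by exact_mod_cast hP
  have hV0 : 0 < Vf k ω := lt_max_of_lt_left (Real.exp_pos _)
  set M : ℝ := max ((k : ℝ) ^ (3 * k) * (1 + ω) ^ (4 * (n * k) + k ^ 2)) (Vf k ω ^ (((k : ℝ) + 1) * (Δ - Δ')))
    with hM
  by_cases hPV : Vf k ω ^ (k + 1) ≤ (P : ℝ)
  · have h34 := hL34 n r j Δ C h1n hnk hr4 hrk hj2 hj9 hj38 hφ hJ P hPV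
    calc (VMV.J k ((n + 1) * k) (Finset.Icc (1 : ℤ) P) : ℝ)
        ≤ (k : ℝ) ^ (3 * k) * (1 + ω) ^ (4 * (n * k) + k ^ 2) * C * (P : ℝ) ^ expo k (n + 1) (dnext k r Δ j) := h34
      _ ≤ M * C * (P : ℝ) ^ expo k (n + 1) Δ' := by
          apply mul_le_mul _ _ (by positivity) (by positivity)
          · exact mul_le_mul_of_nonneg_right (le_max_left _ _) hC
          · apply Real.rpow_le_rpow_of_exponent_le hP1; unfold expo; linarith
      _ = C * M * (P : ℝ) ^ expo k (n + 1) Δ' := by ring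
  · push Not at hPV
    have htriv : (VMV.J k ((n + 1) * k) (Finset.Icc (1 : ℤ) P) : ℝ) ≤
        (P : ℝ) ^ (2 * k) * (VMV.J k (n * k) (Finset.Icc (1 : ℤ) P) : ℝ) := by
      have := VMV.J_add_le k k (n * k) (Finset.Icc (1 : ℤ) P)
      rw [VMV.card_Icc_one, show k + n * k = (n + 1) * k by ring] at this
      exact_mod_cast this
    have hδ0 : 0 ≤ Δ - Δ' := by linarith
    have hsplit : (P : ℝ) ^ (2 * k) * (P : ℝ) ^ expo k n Δ = (P : ℝ) ^ expo k (n + 1) Δ' * (P : ℝ) ^ (Δ - Δ') := by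
      rw [← Real.rpow_natCast, ← Real.rpow_add hP0, ← Real.rpow_add hP0, expo_succ k n Δ' Δ]
      push_cast; ring_nf
    have hsmall : (P : ℝ) ^ (Δ - Δ') ≤ M :=
      calc (P : ℝ) ^ (Δ - Δ') ≤ (Vf k ω ^ (k + 1)) ^ (Δ - Δ') := Real.rpow_le_rpow hP0.le hPV.le hδ0
        _ = Vf k ω ^ (((k : ℝ) + 1) * (Δ - Δ')) := by
            rw [← Real.rpow_natCast, ← Real.rpow_mul hV0.le]; push_cast; ring_nf
        _ ≤ M := le_max_right _ _
    calc (VMV.J k ((n + 1) * k) (Finset.Icc (1 : ℤ) P) : ℝ)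
        ≤ (P : ℝ) ^ (2 * k) * (C * (P : ℝ) ^ expo k n Δ) :=
          htriv.trans (mul_le_mul_of_nonneg_left (hJ P hP) (by positivity))
      _ = C * (P : ℝ) ^ (Δ - Δ') * (P : ℝ) ^ expo k (n + 1) Δ' := by
          rw [mul_left_comm, mul_assoc, hsplit]; ring
      _ ≤ C * M * (P : ℝ) ^ expo k (n + 1) Δ' := by
          apply mul_le_mul_of_nonneg_right _ (by positivity)
          exact mul_le_mul_of_nonneg_left hsmall hC

/-! ### The recursion of Lemma 3.5 with Ford's `r_n`, `j` maximal, `ω = 0.06` -/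

/-- Ford's `r_n = ⌊k − Δ_n/k + 1⌋`. [cite: Ford2002, proof of Lemma 3.6] -/
noncomputable def rL36 (k : ℕ) (Δ : ℝ) : ℕ := ⌊(k : ℝ) - Δ / k + 1⌋₊

/-- The maximal `j` with (3.8): `min(⌊(3 + √(4y+1))/2⌋, ⌊9r/10⌋)`, `y = 2Δ − (k−r)(k−r+1)`.
[cite: Ford2002, (3.8) and the definition of `δ₀`] -/
noncomputable def jL36 (k : ℕ) (Δ : ℝ) : ℕ :=
  min ⌊(3 + Real.sqrt (4 * FordL36.yv k (rL36 k Δ) Δ + 1)) / 2⌋₊ (9 * rL36 k Δ / 10)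

/-- The pairs `(Δ_{m+1}, C_{m+1})` of Lemma 3.5 (`ω = 0.06`, `η = 1.06`), frozen once `Δ ≤ k`.
[cite: Ford2002, Lemma 3.5 (`Δ_{n+1} = δ₀(k,r_n,Δ_n)`, `C_n`)] -/
noncomputable def seqAux (k : ℕ) : ℕ → ℝ × ℝ
  | 0 => (((k : ℝ) ^ 2 - k) / 2, (Nat.factorial k : ℝ))
  | m + 1 =>
    if (k : ℝ) < (seqAux k m).1 then
      (dnext k (rL36 k (seqAux k m).1) (seqAux k m).1 (jL36 k (seqAux k m).1),
        (seqAux k m).2 *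
          max ((k : ℝ) ^ (3 * k) * (1 + 0.06 : ℝ) ^ (4 * ((m + 1) * k) + k ^ 2))
            (Vf k 0.06 ^ (((k : ℝ) + 1) *
              ((seqAux k m).1 - dnext k (rL36 k (seqAux k m).1) (seqAux k m).1 (jL36 k (seqAux k m).1)))))
    else (seqAux k m)

/-! ### One step: admissibility and the bounds of `FordLemma36Step` -/

/-- Auxiliary step (elementary consequence of the standing hypotheses). [folklore] -/
theorem sq_ge_aux {k J : ℝ} (hk : 1191 ≤ k) (h3 : 0.45 * k - 1 ≤ J) : 2 * k - 2 ≤ J ^ 2 := by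
  have h4 : (534 : ℝ) ≤ J := by linarith
  nlinarith


set_option maxHeartbeats 800000 in
/-- **The real step is admissible and satisfies (3.13)–(3.17).** For `1191 ≤ k`, `k < Δ ≤ (k²−k)/2`,
with `r = r(Δ)`, `j = j(Δ)`, `Δ' = δ₀(k,r,Δ)`: `4 ≤ r ≤ k`, (3.8), `φ_i ≥ 1/(k+1)`,
`Δ'/k² ≤ F(Δ/k²)`, `Δ(1 − 2/k) ≤ Δ' ≤ Δ`. [cite: Ford2002, proof of Lemma 3.6, (3.11)–(3.17)] -/
theorem step_facts {k : ℕ} (hk : 1191 ≤ k) {Δ : ℝ} (hΔk : (k : ℝ) < Δ) (hΔ : Δ ≤ ((k : ℝ) ^ 2 - k) / 2) :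
    4 ≤ rL36 k Δ ∧ rL36 k Δ ≤ k ∧ 2 ≤ jL36 k Δ ∧ 10 * jL36 k Δ ≤ 9 * rL36 k Δ ∧
    ((jL36 k Δ : ℝ) - 1) * ((jL36 k Δ : ℝ) - 2) ≤ 2 * Δ - ((k : ℝ) - rL36 k Δ) * ((k : ℝ) - rL36 k Δ + 1) ∧
    (∀ J : ℕ, 1 ≤ J → J ≤ jL36 k Δ → 1 / ((k : ℝ) + 1) ≤ phiF k (rL36 k Δ) Δ (jL36 k Δ) J) ∧
    dnext k (rL36 k Δ) Δ (jL36 k Δ) / (k : ℝ) ^ 2 ≤ FordL36.F k (Δ / (k : ℝ) ^ 2) ∧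
    Δ * (1 - 2 / (k : ℝ)) ≤ dnext k (rL36 k Δ) Δ (jL36 k Δ) ∧
    dnext k (rL36 k Δ) Δ (jL36 k Δ) ≤ Δ := by
  have hkr : (1191 : ℝ) ≤ k := by exact_mod_cast hk
  have hk1000 : (1000 : ℝ) ≤ k := by linarith
  have hk0 : (0 : ℝ) < k := by linarith
  set r : ℕ := rL36 k Δ with hrdef
  -- `r` versus `k − Δ/k + 1`
  have hx0 : 0 ≤ (k : ℝ) - Δ / k + 1 := by
    have : Δ / k ≤ ((k : ℝ) - 1) / 2 := by rw [div_le_iff₀ hk0]; nlinarith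
    linarith
  have hr1 : (k : ℝ) - Δ / k < (r : ℝ) := by
    have := Nat.lt_floor_add_one ((k : ℝ) - Δ / k + 1)
    rw [hrdef, rL36]; linarith
  have hr2 : (r : ℝ) ≤ (k : ℝ) - Δ / k + 1 := by rw [hrdef, rL36]; exact Nat.floor_le hx0
  obtain ⟨hδ1, hδ2, hr3, hr4, hyA, hyB, hy0, hy2⟩ := FordL36.basic_ranges hk1000 hΔk hΔ hr1 hr2
  have hr4N : 4 ≤ r := by
    have h4 : (4 : ℝ) ≤ (r : ℝ) := by linarith
    exact_mod_cast h4
  have hrkN : r ≤ k := by exact_mod_cast hr4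
  have hr0 : (0 : ℝ) < (r : ℝ) := by linarith
  set y : ℝ := FordL36.yv k (r : ℝ) Δ with hydef
  have hyv : y = 2 * Δ - ((k : ℝ) - (r : ℝ)) * ((k : ℝ) - (r : ℝ) + 1) := rfl
  -- `j`
  set j : ℕ := jL36 k Δ with hjdef
  set root : ℝ := (3 + Real.sqrt (4 * y + 1)) / 2 with hroot
  have hsq : Real.sqrt (4 * y + 1) ^ 2 = 4 * y + 1 := Real.sq_sqrt (by linarith)
  have hsq1 : 1 ≤ Real.sqrt (4 * y + 1) := Real.one_le_sqrt.mpr (by linarith)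
  have hjeq : j = min ⌊root⌋₊ (9 * r / 10) := rfl
  have hjle1 : j ≤ ⌊root⌋₊ := by rw [hjeq]; exact Nat.min_le_left _ _
  have hjle2 : j ≤ 9 * r / 10 := by rw [hjeq]; exact Nat.min_le_right _ _
  have hroot2 : 2 ≤ root := by rw [hroot]; linarith
  have hfl2 : 2 ≤ ⌊root⌋₊ := Nat.le_floor (by push_cast; linarith)
  have h9r : 2 ≤ 9 * r / 10 := by omega
  have hj2 : 2 ≤ j := by rw [hjeq]; exact le_min hfl2 h9r
  have hj9 : 10 * j ≤ 9 * r := by omega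
  have hjroot : (j : ℝ) ≤ root := by
    have h1 : (j : ℝ) ≤ (⌊root⌋₊ : ℝ) := by exact_mod_cast hjle1
    exact h1.trans (Nat.floor_le (by linarith))
  have hj38 : ((j : ℝ) - 1) * ((j : ℝ) - 2) ≤ y := by
    -- `(j−1)(j−2) − y = (j − root)(j + root − 3)`
    have e : ((j : ℝ) - 1) * ((j : ℝ) - 2) - y = ((j : ℝ) - root) * ((j : ℝ) + root - 3) := by
      rw [hroot]; nlinarith [hsq]
    have hj2r : (2 : ℝ) ≤ j := by exact_mod_cast hj2
    nlinarith [mul_nonpos_of_nonpos_of_nonneg (sub_nonpos.2 hjroot) (by linarith : (0:ℝ) ≤ (j : ℝ) + root - 3)]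
  -- `j² ≥ 2k − 2`
  have hyge : 2 * (k : ℝ) - 2 ≤ y := FordL36.y_ge hk1000 hΔk hΔ hr1 hr2
  have hjsq : 2 * (k : ℝ) - 2 ≤ (j : ℝ) ^ 2 := by
    rw [hjeq]
    rcases le_total ⌊root⌋₊ (9 * r / 10) with hmin | hmin
    · rw [min_eq_left hmin]
      have h1 : root < (⌊root⌋₊ : ℝ) + 1 := Nat.lt_floor_add_one root
      have h2 : (1 + Real.sqrt (4 * y + 1)) / 2 < (⌊root⌋₊ : ℝ) := by rw [hroot] at h1; linarith
      have h3 : 0 ≤ (1 + Real.sqrt (4 * y + 1)) / 2 := by positivity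
      nlinarith [mul_self_le_mul_self h3 h2.le, hsq]
    · rw [min_eq_right hmin]
      have h1 : 9 * r < 9 * r / 10 * 10 + 10 := Nat.lt_div_mul_add (by norm_num)
      have h2 : (9 : ℝ) * (r : ℝ) < ((9 * r / 10 : ℕ) : ℝ) * 10 + 10 := by
        have : ((9 * r : ℕ) : ℝ) < ((9 * r / 10 * 10 + 10 : ℕ) : ℝ) := by exact_mod_cast h1
        push_cast at this; linarith
      exact sq_ge_aux hkr (by linarith)
  -- the `φ`-recursion, `θ₁`
  set φ : ℕ → ℝ := fun J => phiF k (r : ℝ) Δ j J with hφdef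
  have hφj : φ j = 1 / (r : ℝ) := phiF_self _ _ _ _
  have hφ : ∀ J : ℕ, 1 ≤ J → J < j →
      φ J = 1 / (2 * (r : ℝ)) + (2 * k * (r : ℝ) + (J : ℝ) ^ 2 - J - y) / (4 * k * (r : ℝ)) * φ (J + 1) := by
    intro J hJ1 hJ; rw [hyv]; exact phiF_rec _ _ _ _ hJ1 hJ
  have hj1 : 1 ≤ j := by omega
  obtain ⟨hθ0, hθle⟩ := FordL36.theta_one_le hk0 hr0 hy0 hy2 hφj hφ hj38 hj1
  have hhalf := FordL36.half_pow_le hk1000 hjsq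
  have hθ1 := FordL36.theta_one_le_final hk1000 hΔk hΔ hr1 hr2 (θ₁ := φ 1 - FordL36.phiStar k (r : ℝ) y) hθle hhalf
  have hφ1le : φ 1 ≤ 1 / (r : ℝ) := by
    have := FordL36.phi_le_inv hk0 hr0 hy0 hy2 hφj hφ hj38 (j - 1) (by omega)
    rwa [show j - (j - 1) = 1 by omega] at this
  have hsum : FordL36.phiStar k (r : ℝ) y + (φ 1 - FordL36.phiStar k (r : ℝ) y) ≤ 1 / (r : ℝ) := by linarith
  obtain ⟨hF, hlo, hhi⟩ := FordL36.step_bounds hk1000 hΔk hΔ hr1 hr2 hθ0 hθ1 hsum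
  have hdn : dnext k (r : ℝ) Δ j = Δ - k + (FordL36.phiStar k (r : ℝ) y + (φ 1 - FordL36.phiStar k (r : ℝ) y)) / 2 *
      (2 * k * (r : ℝ) - FordL36.yv k (r : ℝ) Δ) := by
    rw [dnext_eq, ← hyv]; ring
  -- `φ_i ≥ 1/(k+1)`
  have h311 := FordL36.phiStar_ge_inv_succ hk1000 hΔk hΔ hr1 hr2
  have hφpos : ∀ J : ℕ, 1 ≤ J → J ≤ j → 1 / ((k : ℝ) + 1) ≤ phiF k (r : ℝ) Δ j J := fun J hJ1 hJj =>
    h311.trans (FordL36.phiStar_le_phi hk0 hr0 hy0 hy2 hφj hφ hj38 hJ1 hJj)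
  refine ⟨hr4N, hrkN, hj2, hj9, hyv ▸ hj38, hφpos, ?_, ?_, ?_⟩
  · rw [hdn]; exact hF
  · rw [hdn]; exact hlo
  · rw [hdn]; exact hhi

/-- `V(0.06) = 300 k³ log k` for `k ≥ 1191` (`e^{26.5} ≤ 300k³ log k`). [cite: Ford2002, proof of
Lemma 3.6 ("take ω = 0.06, so that V = 300k³ log k")] -/
theorem Vf_eq_Vk {k : ℕ} (hk : 1191 ≤ k) : Vf k 0.06 = FordL36.Vk k := by
  have hkr : (1191 : ℝ) ≤ k := by exact_mod_cast hk
  have hL := FordL36.log_ge_69 (show (1000:ℝ) ≤ k by linarith)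
  unfold Vf FordL36.Vk
  rw [show (18 : ℝ) / 6e-2 = 300 by norm_num]
  apply max_eq_right
  have h1 : Real.exp (3 / 2 + 3 / (2 * 6e-2)) ≤ Real.exp 27 := Real.exp_le_exp.mpr (by norm_num)
  have h2 : Real.exp 27 ≤ (2.7182818286 : ℝ) ^ 27 := by
    rw [show (27 : ℝ) = ((27 : ℕ) : ℝ) * 1 by norm_num, Real.exp_nat_mul]
    exact pow_le_pow_left₀ (Real.exp_pos 1).le Real.exp_one_lt_d9.le 27
  have h3 : (2.7182818286 : ℝ) ^ 27 ≤ 300 * (1191 : ℝ) ^ 3 * 6.9 := by norm_num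
  have h4 : 300 * (1191 : ℝ) ^ 3 * 6.9 ≤ 300 * (k : ℝ) ^ 3 * Real.log k := by
    have : (1191 : ℝ) ^ 3 ≤ (k : ℝ) ^ 3 := pow_le_pow_left₀ (by norm_num) hkr 3
    nlinarith
  linarith

/-! ### The invariant of the recursion -/

/-- The invariant at stage `m` (index `n = m + 1`): `0 < C`, `0 ≤ Δ ≤ (k²−k)/2` and, if `n ≤ k²`,
`J_{nk,k}(P) ≤ C P^{2nk − k(k+1)/2 + Δ}` for `P ≥ 1`. [cite: Ford2002, Lemma 3.5] -/
theorem seqAux_inv {k : ℕ} (hk : 1191 ≤ k) :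
    ∀ m : ℕ, 0 < (seqAux k m).2 ∧ 0 ≤ (seqAux k m).1 ∧ (seqAux k m).1 ≤ ((k : ℝ) ^ 2 - k) / 2 ∧
      (m + 1 ≤ k ^ 2 → ∀ P : ℕ, 1 ≤ P → (VMV.J k ((m + 1) * k) (Finset.Icc (1 : ℤ) P) : ℝ) ≤
        (seqAux k m).2 * (P : ℝ) ^ expo k (m + 1) (seqAux k m).1) := by
  have hkr : (1191 : ℝ) ≤ k := by exact_mod_cast hk
  have hk0 : (0 : ℝ) < k := by linarith
  have hk1 : 1 ≤ k := by omega
  -- Lemma 3.4 at `ω = 0.06`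
  have h34 : Lemma34Hyp k 0.06 := FordVK.lemma34Hyp_of (by omega) (by norm_num) (by norm_num)
  intro m
  induction m with
  | zero =>
    refine ⟨by simp [seqAux]; positivity, ?_, by simp [seqAux], ?_⟩
    · simp only [seqAux]; nlinarith
    · intro _ P hP
      simp only [seqAux, zero_add, one_mul]
      have hP0 : (0 : ℝ) < P := by exact_mod_cast hP
      have hexpo : expo k 1 (((k : ℝ) ^ 2 - k) / 2) = k := by
        unfold expo
        have hT : ((k * (k + 1) / 2 : ℕ) : ℝ) = (k : ℝ) * ((k : ℝ) + 1) / 2 := by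
          rw [Nat.cast_div (Nat.even_mul_succ_self k).two_dvd (by norm_num)]; push_cast; ring
        rw [hT]; push_cast; ring
      rw [hexpo, Real.rpow_natCast]
      have hJ := FordVK.J_self_le k (Finset.Icc (1 : ℤ) P)
      rw [VMV.card_Icc_one] at hJ
      exact_mod_cast hJ
  | succ m ih =>
    obtain ⟨hC, hΔ0, hΔ, hJ⟩ := ih
    by_cases hlt : (k : ℝ) < (seqAux k m).1
    · -- the real step
      have e : seqAux k (m + 1) = (dnext k (rL36 k (seqAux k m).1) (seqAux k m).1 (jL36 k (seqAux k m).1),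
          (seqAux k m).2 * max ((k : ℝ) ^ (3 * k) * (1 + 0.06 : ℝ) ^ (4 * ((m + 1) * k) + k ^ 2))
            (Vf k 0.06 ^ (((k : ℝ) + 1) * ((seqAux k m).1 -
              dnext k (rL36 k (seqAux k m).1) (seqAux k m).1 (jL36 k (seqAux k m).1))))) := by
        rw [seqAux, if_pos hlt]
      obtain ⟨hr4, hrk, hj2, hj9, hj38, hφpos, _, hlo, hhi⟩ := step_facts hk hlt hΔ
      rw [e]
      refine ⟨?_, ?_, hhi.trans hΔ, ?_⟩
      · exact mul_pos hC (lt_max_of_lt_left (by positivity))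
      · have : 0 ≤ (seqAux k m).1 * (1 - 2 / (k : ℝ)) :=
          mul_nonneg hΔ0 (by rw [sub_nonneg, div_le_one hk0]; linarith)
        linarith
      · intro hm P hP
        have hm' : m + 1 ≤ k ^ 2 := by omega
        have hnk : (m + 1) * k ≤ k ^ 3 := by
          calc (m + 1) * k ≤ k ^ 2 * k := Nat.mul_le_mul_right k hm'
            _ = k ^ 3 := by ring
        have := lemma35_step hk1 (by norm_num) h34 hC.le (by omega) hnk hr4 hrk hj2 hj9 hj38 hφpos le_rfl hhi
          (hJ hm') P hP
        simpa [add_assoc] using this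
    · -- frozen
      have e : seqAux k (m + 1) = seqAux k m := by rw [seqAux, if_neg hlt]
      rw [e]
      refine ⟨hC, hΔ0, hΔ, ?_⟩
      intro hm P hP
      have hP0 : (0 : ℝ) < P := by exact_mod_cast hP
      have hP1 : (1 : ℝ) ≤ P := by exact_mod_cast hP
      have hJm := hJ (by omega) P hP
      have htriv : (VMV.J k ((m + 1 + 1) * k) (Finset.Icc (1 : ℤ) P) : ℝ) ≤
          (P : ℝ) ^ (2 * k) * (VMV.J k ((m + 1) * k) (Finset.Icc (1 : ℤ) P) : ℝ) := by
        have := VMV.J_add_le k k ((m + 1) * k) (Finset.Icc (1 : ℤ) P)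
        rw [VMV.card_Icc_one, show k + (m + 1) * k = (m + 1 + 1) * k by ring] at this
        exact_mod_cast this
      calc (VMV.J k ((m + 1 + 1) * k) (Finset.Icc (1 : ℤ) P) : ℝ)
          ≤ (P : ℝ) ^ (2 * k) * ((seqAux k m).2 * (P : ℝ) ^ expo k (m + 1) (seqAux k m).1) :=
            htriv.trans (mul_le_mul_of_nonneg_left hJm (by positivity))
        _ = (seqAux k m).2 * ((P : ℝ) ^ expo k (m + 1) (seqAux k m).1 * (P : ℝ) ^ ((2 * k : ℕ) : ℝ)) := by
            rw [Real.rpow_natCast]; ring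
        _ = (seqAux k m).2 * (P : ℝ) ^ (expo k (m + 1) (seqAux k m).1 + 2 * k) := by
            rw [← Real.rpow_add hP0]; push_cast; ring_nf
        _ ≤ (seqAux k m).2 * (P : ℝ) ^ expo k (m + 1 + 1) (seqAux k m).1 := by
            apply mul_le_mul_of_nonneg_left _ hC.le
            apply Real.rpow_le_rpow_of_exponent_le hP1
            rw [expo_succ k (m + 1) (seqAux k m).1 (seqAux k m).1]; linarith

/-! ### The row for `k ≥ 1191` -/

/-- **Theorem 3, row `(ρ, θ) = (3.21432, 2.3291)` of (1.7) for `k ≥ 1191`, from Lemma 3.4**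
(via the data of Lemma 3.5 and `FordL36.row_of_lemma35_data`).
[cite: Ford2002, Theorem 3 and its proof ("Suppose first that k ≥ 1000 …"), Lemmas 3.5–3.6] -/
theorem row_ge_1191 {k : ℕ} (hk : 1191 ≤ k) :
    ∃ s₃ : ℕ, 1 ≤ s₃ ∧ (s₃ : ℝ) ≤ 3.21432 * (k : ℝ) ^ 2 ∧ ∀ P : ℕ, 1 ≤ P →
      (VMV.J k s₃ (Finset.Icc (1 : ℤ) P) : ℝ) ≤ (k : ℝ) ^ ((2.3291 : ℝ) * (k : ℝ) ^ 3)
        * (P : ℝ) ^ ((2 * s₃ : ℝ) - ((k * (k + 1) / 2 : ℕ) : ℝ) + 0.001 * (k : ℝ) ^ 2) := by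
  have hkr : (1191 : ℝ) ≤ k := by exact_mod_cast hk
  have hk0 : (0 : ℝ) < k := by linarith
  have hk2 : (0 : ℝ) < (k : ℝ) ^ 2 := by positivity
  have hinv := seqAux_inv hk
  set d : ℕ → ℝ := fun n => (seqAux k (n - 1)).1 / (k : ℝ) ^ 2 with hd
  set C : ℕ → ℝ := fun n => (seqAux k (n - 1)).2 with hCdef
  have hdk : ∀ n, (k : ℝ) ^ 2 * d n = (seqAux k (n - 1)).1 := fun n => by
    rw [hd]; field_simp
  -- the step equations
  have hstep : ∀ n, 1 ≤ n → (k : ℝ) < (seqAux k (n - 1)).1 →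
      seqAux k n = (dnext k (rL36 k (seqAux k (n - 1)).1) (seqAux k (n - 1)).1 (jL36 k (seqAux k (n - 1)).1),
        (seqAux k (n - 1)).2 * max ((k : ℝ) ^ (3 * k) * (1 + 0.06 : ℝ) ^ (4 * ((n - 1 + 1) * k) + k ^ 2))
          (Vf k 0.06 ^ (((k : ℝ) + 1) * ((seqAux k (n - 1)).1 -
            dnext k (rL36 k (seqAux k (n - 1)).1) (seqAux k (n - 1)).1 (jL36 k (seqAux k (n - 1)).1))))) := by
    intro n hn hlt
    obtain ⟨m, rfl⟩ : ∃ m, n = m + 1 := ⟨n - 1, by omega⟩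
    rw [Nat.add_sub_cancel] at hlt ⊢
    rw [seqAux, if_pos hlt]
  have hfrozen : ∀ n, 1 ≤ n → ¬ (k : ℝ) < (seqAux k (n - 1)).1 → seqAux k n = seqAux k (n - 1) := by
    intro n hn hlt
    obtain ⟨m, rfl⟩ : ∃ m, n = m + 1 := ⟨n - 1, by omega⟩
    rw [Nat.add_sub_cancel] at hlt ⊢
    rw [seqAux, if_neg hlt]
  have h1 : d 1 = (1 - 1 / (k : ℝ)) / 2 := by
    show (seqAux k (1 - 1)).1 / (k : ℝ) ^ 2 = _
    simp only [Nat.sub_self, seqAux]; field_simp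
  have hanti : ∀ n, 1 ≤ n → d (n + 1) ≤ d n := by
    intro n hn
    show (seqAux k (n + 1 - 1)).1 / (k : ℝ) ^ 2 ≤ (seqAux k (n - 1)).1 / (k : ℝ) ^ 2
    rw [Nat.add_sub_cancel]
    apply div_le_div_of_nonneg_right _ hk2.le
    by_cases hlt : (k : ℝ) < (seqAux k (n - 1)).1
    · rw [hstep n hn hlt]
      exact (step_facts hk hlt (hinv (n - 1)).2.2.1).2.2.2.2.2.2.2.2
    · rw [hfrozen n hn hlt]
  have hrec : ∀ n, 1 ≤ n → 1 / (k : ℝ) < d n → d (n + 1) ≤ FordL36.F k (d n) := by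
    intro n hn hdn
    have hlt : (k : ℝ) < (seqAux k (n - 1)).1 := by
      have : 1 / (k : ℝ) < (seqAux k (n - 1)).1 / (k : ℝ) ^ 2 := hdn
      rw [div_lt_div_iff₀ hk0 hk2] at this; nlinarith
    show (seqAux k (n + 1 - 1)).1 / (k : ℝ) ^ 2 ≤ FordL36.F k ((seqAux k (n - 1)).1 / (k : ℝ) ^ 2)
    rw [Nat.add_sub_cancel, hstep n hn hlt]
    exact (step_facts hk hlt (hinv (n - 1)).2.2.1).2.2.2.2.2.2.1
  have hlow : ∀ n, 1 ≤ n → 1 / (k : ℝ) < d n → d n * (1 - 2 / (k : ℝ)) ≤ d (n + 1) := by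
    intro n hn hdn
    have hlt : (k : ℝ) < (seqAux k (n - 1)).1 := by
      have : 1 / (k : ℝ) < (seqAux k (n - 1)).1 / (k : ℝ) ^ 2 := hdn
      rw [div_lt_div_iff₀ hk0 hk2] at this; nlinarith
    show (seqAux k (n - 1)).1 / (k : ℝ) ^ 2 * (1 - 2 / (k : ℝ)) ≤ (seqAux k (n + 1 - 1)).1 / (k : ℝ) ^ 2
    rw [Nat.add_sub_cancel, hstep n hn hlt]
    have := (step_facts hk hlt (hinv (n - 1)).2.2.1).2.2.2.2.2.2.2.1
    rw [div_mul_eq_mul_div]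
    exact div_le_div_of_nonneg_right this hk2.le
  have hdpos : ∀ n, 1 ≤ n → 0 ≤ d n := fun n _ => div_nonneg (hinv (n - 1)).2.1 hk2.le
  have hCpos : ∀ n, 1 ≤ n → 0 < C n := fun n _ => (hinv (n - 1)).1
  have hC1 : C 1 = (Nat.factorial k : ℝ) := by
    show (seqAux k (1 - 1)).2 = _; simp [seqAux]
  have hVk := Vf_eq_Vk hk
  have hC : ∀ n, 2 ≤ n → C n ≤ C (n - 1) *
      max (FordL36.Hn k n) (FordL36.Vk k ^ (((k : ℝ) + 1) * ((k : ℝ) ^ 2 * d (n - 1) - (k : ℝ) ^ 2 * d n))) := by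
    intro n hn
    rw [hdk, hdk]
    show (seqAux k (n - 1)).2 ≤ (seqAux k (n - 1 - 1)).2 *
      max (FordL36.Hn k n) (FordL36.Vk k ^ (((k : ℝ) + 1) * ((seqAux k (n - 1 - 1)).1 - (seqAux k (n - 1)).1)))
    obtain ⟨m, rfl⟩ : ∃ m, n = m + 2 := ⟨n - 2, by omega⟩
    rw [show m + 2 - 1 = m + 1 by omega, show m + 1 - 1 = m by omega]
    have hHn : FordL36.Hn k (m + 2) = (k : ℝ) ^ (3 * k) * (1 + 0.06 : ℝ) ^ (4 * ((m + 1) * k) + k ^ 2) := by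
      unfold FordL36.Hn
      rw [show m + 2 - 1 = m + 1 by omega, show 4 * k * (m + 1) = 4 * ((m + 1) * k) by ring]
      norm_num
    by_cases hlt : (k : ℝ) < (seqAux k m).1
    · have e := hstep (m + 1) (by omega) (by rwa [Nat.add_sub_cancel])
      rw [Nat.add_sub_cancel] at e
      rw [e, hHn, hVk]
    · have e := hfrozen (m + 1) (by omega) (by rwa [Nat.add_sub_cancel])
      rw [Nat.add_sub_cancel] at e
      rw [e, sub_self, mul_zero, Real.rpow_zero]
      have h1 := FordL36.one_le_Hn k (m + 2) (by omega)
      have hCm := (hinv m).1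
      calc (seqAux k m).2 = (seqAux k m).2 * 1 := (mul_one _).symm
        _ ≤ (seqAux k m).2 * max (FordL36.Hn k (m + 2)) 1 :=
            mul_le_mul_of_nonneg_left (le_max_right _ _) hCm.le
  have hJ : ∀ n : ℕ, 1 ≤ n → n ≤ k ^ 2 → ∀ P : ℕ, 1 ≤ P →
      (VMV.J k (n * k) (Finset.Icc (1 : ℤ) P) : ℝ) ≤
        C n * (P : ℝ) ^ ((2 * (n * k : ℕ) : ℝ) - ((k * (k + 1) / 2 : ℕ) : ℝ) + (k : ℝ) ^ 2 * d n) := by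
    intro n hn hnk P hP
    rw [hdk]
    obtain ⟨m, rfl⟩ : ∃ m, n = m + 1 := ⟨n - 1, by omega⟩
    rw [Nat.add_sub_cancel]
    have := (hinv m).2.2.2 hnk P hP
    unfold expo at this
    convert this using 3
    push_cast; ring
  exact FordL36.row_of_lemma35_data hk h1 hanti hrec hlow hdpos hCpos hC1 hC hJ

end FordP1
end Literature.NumberTheory.LFunctions
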